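import Mathlib.RingTheory.AdicCompletion.Basic
import Mathlib.RingTheory.Ideal.MinimalPrime.Basic
import Mathlib.RingTheory.Valuation.ValuationSubring
import Mathlib.RingTheory.TensorProduct.Maps
import Literature.NumberTheory.GaloisRepresentations.PstWeilDeligne
import HarnessLib

/-!
# Crystalline deformation rings (Kisin) as reduced `p`-torsion-free quotients of the universal
# lifting ring characterised by their `ℚ̄_p`-points (Barnet-Lamb–Gee–Geraghty–Taylor §1.3–1.4)

Trunk: GaloisRepresentations (definition item `defn-CrystallineDeformationRing`, wanted by route
WachCensus of the summit `Langlands` to type its cruxes `SeedsOverQp2`, `ComponentCensusUnram`,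
`PD2Unram`, and by the definition item `IsPotentiallyDiagonalizable`).

## Mathematics

Let `p` be a prime, `L/ℚ_p` a finite extension inside `ℚ̄_p` with ring of integers `𝒪`, maximal
ideal `λ` and residue field `𝔽 = 𝒪/λ`, let `Γ` be a profinite group (in §1.4 of [BLGGT]:
`Γ = G_K` for a finite `K/ℚ_p`) and `ρ̄ : Γ → GL_n(𝔽)` continuous. The *universal lifting ring*
`R^□_{𝒪,ρ̄}` is the complete noetherian local `𝒪`-algebra with residue field `𝔽` carrying the
universal lifting `ρ^□ : Γ → GL_n(R^□_{𝒪,ρ̄})` of `ρ̄` (framed deformations: Kisin, *Moduli of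
finite flat group schemes and modularity* (2009), §2.3; [BLGGT] §1.2). A `ℚ̄_p`-point
`x : R^□_{𝒪,ρ̄} → ℚ̄_p` (an `𝒪`-algebra homomorphism; its image lies in the integers of a finite
extension of `L`) "corresponds to" the continuous representation `ρ_x = x ∘ ρ^□ : Γ → GL_n(ℚ̄_p)`
([BLGGT] §1.2, p. 9), and conversely a continuous `ρ : Γ → GL_n(𝒪_{ℚ̄_p})` reducing to `ρ̄`
defines a point ([BLGGT] §1.3, definition of "connects").

[BLGGT] §1.3–1.4 single out quotients of `R^□_{𝒪,ρ̄}` **uniquely characterised by requiring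
that they are reduced, without `p`-torsion, and that a `ℚ̄_p`-point of `R^□_{𝒪,ρ̄}` factors
through the quotient if and only if the corresponding `ρ : Γ → GL_n(ℚ̄_p)` has a specified
property `𝒞`** (verbatim, [BLGGT] §1.4, p. 13: "The universal lifting ring `R^□_{𝒪,ρ̄}` has
various important quotients `R^□_{𝒪,ρ̄,{H_τ},*}` which are uniquely characterized by requiring
that they are reduced without `l`-torsion and that a `ℚ̄_l`-point of `R^□_{𝒪,ρ̄}` factors through
`R^□_{𝒪,ρ̄,{H_τ},*}` if and only if it corresponds to a representation `ρ : G_K → GL_n(ℚ̄_l)`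
which is de Rham with Hodge–Tate numbers `HT_τ(ρ) = H_τ` for all `τ : K ↪ ℚ̄_l` and which has
a further specified property `𝒫_*`"; the instances listed there are `* = cris, semis, K'-cris,
K'-semis, cr-ord, ss-ord`, and §1.3 has `R^□_{𝒪,ρ̄,𝒞}` for a set `𝒞` of components and
`R^□_{𝒪,ρ̄,K'-nr}`). For `* = cris` this quotient is **Kisin's crystalline deformation ring**
of `p`-adic Hodge type `v = {H_τ}` (Kisin 2008, Cor. (2.7.7) with trivial Galois type, (3.3.3),
Thm. (3.3.8): `Spec` of its generic fibre is formally smooth and equidimensional of dimension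
`n² + dim_E ad D_{E,K}/Fil⁰ ad D_{E,K}`); the version "crystalline with Hodge–Tate weights in
`[a, b]`" is Kisin's Theorem of the introduction / Thm. (2.5.5) (semi-stable, weights in `[0,h]`)
cut down by `N = 0` (Cor. (2.7.7)).

## What this file defines

* `Literature.NumberTheory.GaloisRepresentations.ReducesTo 𝒪 ρ ρ̄` — a homomorphism
  `ρ : Γ → GL_n(ℚ̄_p)` is integral and reduces, modulo the maximal ideal of `𝒪_{ℚ̄_p}`, to
  `ρ̄ : Γ → GL_n(k)` through the coefficient maps `𝒪 → k`, `𝒪 → ℚ̄_p`.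
* `Literature.NumberTheory.GaloisRepresentations.PointwiseLiftingRing Γ p 𝒪 k ρ̄ 𝒞` — the
  INTERFACE (in the style of the accepted `PstWeilDeligneData`) of a quotient of the universal
  lifting ring of the kind just described, for an arbitrary condition `𝒞` on continuous
  `ρ : Γ → GL_n(ℚ̄_p)`: a complete noetherian local `𝒪`-algebra `R` with residue field `k`
  (`residueMap`), reduced and `p`-torsion free, a lifting `lift : Γ → GL_n(R)` of `ρ̄`,
  continuous for the `𝔪_R`-adic topology, whose matrix entries topologically generate `R` over
  `𝒪` (`exists_sub_mem`; this is what makes `R` a QUOTIENT of `R^□_{𝒪,ρ̄}` — the image of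
  `R^□_{𝒪,ρ̄} → R` is the closure of the `𝒪`-algebra generated by the entries, [BLGGT] proof of
  Lemma 1.2.1), and the characterisation of its `ℚ̄_p`-points: every `𝒪`-algebra homomorphism
  `x : R → ℚ̄_p` specialises `lift` to a continuous `𝒞`-representation reducing to `ρ̄`
  (`point_spec`), and every continuous `𝒞`-representation `Γ → GL_n(𝒪_{ℚ̄_p})` reducing to `ρ̄`
  arises from exactly one such `x` (`existsUnique_point`). These axioms determine `R` as the
  quotient of `R^□_{𝒪,ρ̄}` by the ideal of functions vanishing at all `𝒞`-points (reduced +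
  `p`-torsion free + `R^□[1/p]` Jacobson), i.e. they are the cited unique characterisation.
  The interface describes the quotient WHEN IT IS NON-ZERO ([BLGGT] §1.4: "each ring
  `R^□_{𝒪,ρ̄,{H_τ},*}` is either zero or equidimensional ..."): a local ring is non-zero, and the
  quotient is zero exactly when `ρ̄` has no `𝒞`-lift at all (then there is nothing to describe).
  API: `specialize`, `liftAt`, `pointOf`, the bijection `pointEquiv` between `ℚ̄_p`-points and
  `𝒞`-lifts, the base change `pointQbar` of a point to the geometric generic fibre
  `ℚ̄_p ⊗_𝒪 R`, its set of irreducible components `genericFibreComponents` (minimal primes of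
  `ℚ̄_p ⊗_𝒪 R`, [BLGGT] "`R^□ ⊗ ℚ̄_l`") and the relation `OnCommonComponent x y` ("`x`, `y` lie
  on a common irreducible component of `Spec (R ⊗ ℚ̄_p)`", the relation underlying [BLGGT]'s
  `ρ₁ ∼ ρ₂`).
* `FramedRep.IsCrystallineWith 𝔅c ρ` — Fontaine's definition: `ρ : Γ_K → GL_n(ℚ̄_p)` is
  crystalline relative to a crystalline period-ring datum `𝔅c` (accepted
  `CrystallinePeriodRingData`, intended `B_cris`): a finite model (accepted `HasQlModel`,
  `restrictScalarsQl`) is `𝔅c`-admissible (accepted `GaloisRep.IsCrystalline`) — parallel to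
  the accepted `FramedRep.IsDeRhamWith`. `FramedRep.IsDeRhamWithWeightsIn 𝔅dR a b ρ` — de Rham
  relative to `𝔅dR` (intended `B_dR`) with all Hodge–Tate weights (accepted
  `PeriodRingData.hodgeTateWeights`) in `[a, b]`.
* `PstWeilDeligneData.IsCrystallineFramed 𝔇 ρ` — crystalline, characterised through `D_pst`
  relative to the `p`-adic Hodge datum `𝔇 : PstWeilDeligneData K p` that the summit statement
  `Langlands` carries (`ReciprocityData.pst`): de Rham and the Weil–Deligne representation is
  unramified with `N = 0` (the summit's own phrasing of "crystalline at `v ∣ p`"); PROVED: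
  unramified ⇒ crystalline (`isCrystallineFramed_of_isLocallyUnramified`, from the datum's
  axioms). `PstWeilDeligneData.IsDeRhamWithWeightsIn 𝔇 a b ρ` (weights via `𝔇.𝔅`).
* `Literature.NumberTheory.GaloisRepresentations.CrystallineDeformationRing p K 𝒪 k ρ̄ 𝔇 H` —
  **the crystalline deformation ring of `ρ̄ : Γ_K → GL_n(k)` of Hodge type `H`**: the
  `PointwiseLiftingRing` for the condition "`𝔇`-crystalline and `H`". The Hodge-type
  condition `H` is a parameter: [BLGGT]'s `R^□_{𝒪,ρ̄,{H_τ},cris}` / Kisin's `R^{□,v}_{cr}` is the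
  instance `H ρ := (∀ τ, HT_τ(ρ) = H_τ)` (labelled Hodge–Tate weights are the separate
  definition item `LabelledHodgeTateWeights` and are deliberately not re-defined here), and
  Kisin's interval ring is the instance `H := 𝔇.IsDeRhamWithWeightsIn a b`, available now.
* Predicates on the datum: `PstWeilDeligneData.UnramifiedWeightsZero 𝔇` (unramified ⇒ weights
  `0`) and `PstWeilDeligneData.HasCrystallineDeformationRings 𝔇` (Kisin's existence theorem,
  interval form, for `𝔇`); PROVED consequence `HasCrystallineDeformationRings.nonempty_one`
  (the crystalline deformation ring of the trivial `ρ̄` with weights in `[a, b] ∋ 0` exists).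
* Named fact (D-0014) `CrystallineDeformationRing.nonempty`: the genuine datum exists with the
  given `ℚ_p`-algebra structure and has both properties (Kisin 2008, Theorem of the
  Introduction, Thm. (2.5.5), Cor. (2.7.7); [BLGGT] §1.4; Fontaine Exposé III §5) — a
  refinement of the accepted `PstWeilDeligneData.nonempty`, in the same shape.

## Design notes

* **Points are `𝒪`-algebra maps `R → ℚ̄_p`; lifts are `𝒪_{ℚ̄_p}`-valued.** This is [BLGGT]'s
  convention (§1.2: "`ℚ̄_l`-point"; §1.3: "`ρ_i : G_K → GL_n(𝒪_{ℚ̄_l})` ... define points").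
  Such an `x` automatically has image in the integers of a finite extension of `L` and is
  continuous, and a continuous `𝒪_{ℚ̄_p}`-valued `ρ` has values in some `GL_n(𝒪_{L'})`
  (compactness); the interface states the resulting properties (`point_spec` includes continuity
  and reduction of `x ∘ lift`, `existsUnique_point` includes uniqueness) rather than re-deriving
  them, so that no topology on `R` is needed: continuity of `lift` is stated through the
  open-ness of the preimages of the congruence subgroups `1 + M_n(𝔪_R^m)`.
* **No universal lifting ring is constructed.** The tree has no `R^□_{𝒪,ρ̄}`; the condition
  `exists_sub_mem` (entries of `lift` generate a dense `𝒪`-subalgebra for the `𝔪_R`-adic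
  topology) is the intrinsic form of "`R^□_{𝒪,ρ̄} → R` is surjective" (a local map of complete
  local noetherian rings with dense image is surjective).
* **Coefficients.** `𝒪` is any commutative ring with maps to `ℚ̄_p` and to the residue field `k`
  (intended: `𝒪 = 𝒪_L ⊆ ℚ̄_p`, `k = 𝒪_L/λ`, or `k ⊇ 𝔽` a chosen finite field with `𝒪 ↠ k`);
  `ρ̄` is a `FramedRep Γ k n = Γ →ₜ* GL_n(k)` (for `Γ = Γ_K`: the accepted `ModPGaloisRep K k n`,
  discrete `k`). The residue field of `R` is identified with `k` through the `𝒪`-algebra map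
  `residueMap : R → k` (surjective as soon as `𝒪 → k` is, with kernel `𝔪_R`:
  `residueMap_surjective`, `ker_residueMap`).
* **Why the deformation ring is keyed to `PstWeilDeligneData` and existence is a predicate on
  it.** A named fact of the shape `∃ 𝔅c 𝔅dR, ∀ …, Nonempty (ring)` over bare period-ring data is
  provable for a degenerate reason (review of the first version of this file): the datum
  `B := K` with trivial `Γ_K`-action satisfies every field of `PeriodRingData`, makes only the
  trivial representation admissible, and then `R := 𝒪_L`, `lift := 1` is a witness. The
  accepted `PstWeilDeligneData` excludes such data by its axioms (unramified ⇒ de Rham, etc.)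
  and is the datum every summit-facing statement already holds; so crystallinity is read off
  `𝔇`, Kisin's theorem is the PREDICATE `𝔇.HasCrystallineDeformationRings` that consumers
  hypothesize about the datum in scope, and the one named fact asserts it (with
  `UnramifiedWeightsZero`) of the genuine datum, exactly as `PstWeilDeligneData.nonempty` does.
* **Definitions, not facts.** Every `def … : Prop` below except
  `CrystallineDeformationRing.nonempty` takes its subject as an explicit binder (a predicate),
  as in the accepted `PAdicHodge` design note.
* Not vendored here (need labelled Hodge–Tate weights): Kisin's Thm. (3.3.8) (formal smoothness
  and the dimension `n² + Σ_τ dim GL_n/P_{λ_τ}` of the generic fibre of `R^{□,λ}_{cr}`) and the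
  base-change compatibility `K'/K`; they are statements about
  `CrystallineDeformationRing p K 𝒪 k ρ̄ 𝔇 (fun ρ ↦ ∀ τ, HT_τ ρ = λ τ)`.

## References

* [BLGGT] T. Barnet-Lamb, T. Gee, D. Geraghty, R. Taylor, *Potential automorphy and change of
  weight*, Ann. of Math. 179 (2014), §1.2 (p. 9), §1.3 (p. 12), §1.4 (pp. 13–14) of
  arXiv:1010.2561. [BarnetlambEtAl2014]
* M. Kisin, *Potentially semi-stable deformation rings*, J. Amer. Math. Soc. 21 (2008), 513–546:
  Introduction (Theorem), Thm. (2.5.5), Cor. (2.6.2), Thm. (2.7.6), Cor. (2.7.7), (3.3.3),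
  Thm. (3.3.4), Thm. (3.3.8). [Kisin2007]
* M. Kisin, *Moduli of finite flat group schemes, and modularity*, Ann. of Math. 170 (2009),
  §2.3 (framed deformations). [KisinModuli2009]
* B. Mazur, *An introduction to the deformation theory of Galois representations* (1997), §§8–10
  (universal deformation rings). [Mazur1997Deformation]
* J.-M. Fontaine, *Représentations `p`-adiques semi-stables*, Astérisque 223 (1994), Exposé III
  §5.1 (crystalline = `B_cris`-admissible; §5: unramified ⇒ crystalline). [FontaineAsterisque223III]
* J.-M. Fontaine, *Représentations `ℓ`-adiques potentiellement semi-stables*, Astérisque 223 (1994),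
  321–347, Exposé VIII §1.3, §2.3.7 (the Weil–Deligne representation of a potentially
  semi-stable representation; crystalline ⇔ `N = 0` and inertia trivial). [FontaineAsterisque223VIII]
-/

noncomputable section

open scoped MatrixGroups TensorProduct
open Field IsLocalRing

namespace Literature.NumberTheory.GaloisRepresentations

/-! ### Reduction of `ℚ̄_p`-valued homomorphisms modulo the maximal ideal of `𝒪_{ℚ̄_p}` -/

section ReducesTo

variable {Γ : Type*} [Group Γ] {p : ℕ} [Fact p.Prime] (O : Type*) [CommRing O]
  [Algebra O (PadicAlgCl p)] {k : Type*} [Field k] [Algebra O k] {n : ℕ}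

/-- **`ρ : Γ → GL_n(ℚ̄_p)` reduces to `ρ̄ : Γ → GL_n(k)` (through `𝒪`)**: for every `γ`, every
matrix position `(i, j)` and every lift `a ∈ 𝒪` of the residue `ρ̄(γ)_{ij} ∈ k` along `𝒪 → k`,
the entry `ρ(γ)_{ij}` is congruent to the image of `a` in `ℚ̄_p` modulo the maximal ideal
`{z : ‖z‖ < 1}` of `𝒪_{ℚ̄_p}`. In the intended situation (`𝒪 = 𝒪_L ⊆ ℚ̄_p` the integers of a
finite `L/ℚ_p`, `𝒪 → k = 𝒪/λ` the residue map, so that `𝒪 → ℚ̄_p` maps `λ` into the maximal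
ideal of `𝒪_{ℚ̄_p}`) this says precisely: `ρ` takes values in `GL_n(𝒪_{ℚ̄_p})`
(`ReducesTo.norm_le_one`) and `ρ mod 𝔪_{ℚ̄_p} = ρ̄ ⊗_k 𝔽̄_p`, i.e. `ρ` is a lift of `ρ̄` in the
sense of [BLGGT] §1.3 ("the reduction `ρ̄₁ = ρ₁ mod 𝔪_{ℚ̄_l}`").
[cite: BarnetlambEtAl2014, §1.3] -/
def ReducesTo (ρ : Γ →* GL (Fin n) (PadicAlgCl p)) (ρbar : Γ →* GL (Fin n) k) : Prop :=
  ∀ (γ : Γ) (i j : Fin n) (a : O), algebraMap O k a = (ρbar γ : Matrix (Fin n) (Fin n) k) i j →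
    ‖((ρ γ : GL (Fin n) (PadicAlgCl p)) : Matrix (Fin n) (Fin n) (PadicAlgCl p)) i j -
        algebraMap O (PadicAlgCl p) a‖ < 1

variable {O}

/-- If `𝒪 → ℚ̄_p` lands in `𝒪_{ℚ̄_p}` and `𝒪 → k` is surjective, a homomorphism reducing to some
`ρ̄` has all its matrix entries in `𝒪_{ℚ̄_p} = {z : ‖z‖ ≤ 1}` (ultrametric inequality). [folklore] -/
theorem ReducesTo.norm_le_one {ρ : Γ →* GL (Fin n) (PadicAlgCl p)} {ρbar : Γ →* GL (Fin n) k}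
    (h : ReducesTo O ρ ρbar) (hO : ∀ a : O, ‖algebraMap O (PadicAlgCl p) a‖ ≤ 1)
    (hk : Function.Surjective (algebraMap O k)) (γ : Γ) (i j : Fin n) :
    ‖((ρ γ : GL (Fin n) (PadicAlgCl p)) : Matrix (Fin n) (Fin n) (PadicAlgCl p)) i j‖ ≤ 1 := by
  obtain ⟨a, ha⟩ := hk ((ρbar γ : Matrix (Fin n) (Fin n) k) i j)
  have h1 := h γ i j a ha
  set z := ((ρ γ : GL (Fin n) (PadicAlgCl p)) : Matrix (Fin n) (Fin n) (PadicAlgCl p)) i j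
  have hz : z = (z - algebraMap O (PadicAlgCl p) a) + algebraMap O (PadicAlgCl p) a := by ring
  rw [hz]
  refine (IsUltrametricDist.norm_add_le_max _ _).trans (max_le h1.le (hO a))

end ReducesTo

/-! ### Reduced `p`-torsion-free quotients of the universal lifting ring cut out by their points -/

/-- **A reduced, `p`-torsion-free quotient of the universal lifting ring of `ρ̄` characterised by
its `ℚ̄_p`-points** ([BLGGT] §1.3 `R^□_{𝒪,ρ̄,𝒞}`, §1.4 `R^□_{𝒪,ρ̄,{H_τ},*}`; Kisin's
potentially semi-stable / crystalline deformation rings are the instances `𝒞 =` "potentially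
semi-stable (crystalline) of fixed Galois and `p`-adic Hodge type"). Parameters: a topological
group `Γ` (intended profinite, e.g. `Γ_K`), the prime `p`, a coefficient ring `𝒪` with its maps
to `ℚ̄_p` and to the residue field `k` (intended `𝒪 = 𝒪_L ⊆ ℚ̄_p`, `k = 𝒪_L/λ`), the residual
representation `ρ̄ : Γ →ₜ* GL_n(k)` and the condition `𝒞` on continuous `ρ : Γ → GL_n(ℚ̄_p)`.
Fields: the ring `R`, a complete (`isAdicComplete`) noetherian local `𝒪`-algebra with residue
field `k` (`residueMap`), reduced (`isReduced`) and without `p`-torsion (`torsionFree`); the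
lifting `lift : Γ → GL_n(R)` of `ρ̄` (`residueMap_lift`), continuous for the `𝔪_R`-adic
topology (`isOpen_setOf_lift`), whose entries topologically generate `R` over `𝒪`
(`exists_sub_mem`: `R` is a quotient of the universal lifting ring `R^□_{𝒪,ρ̄}`); and the
characterisation of the `ℚ̄_p`-points: each `𝒪`-algebra map `x : R → ℚ̄_p` specialises `lift`
to a continuous representation reducing to `ρ̄` and satisfying `𝒞` (`point_spec`), and each
continuous `ρ : Γ → GL_n(𝒪_{ℚ̄_p})` reducing to `ρ̄` and satisfying `𝒞` is the specialisation of
`lift` along exactly one such `x` (`existsUnique_point`). "Uniquely characterized by requiring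
that they are reduced without `l`-torsion and that a `ℚ̄_l`-point of `R^□_{𝒪,ρ̄}` factors
through [the quotient] if and only if it corresponds to a representation ... which has [the]
property" ([BLGGT] §1.4, p. 13). The structure describes this quotient when it is NON-ZERO
(a local ring is non-zero; the quotient is the zero ring exactly when `ρ̄` admits no `𝒞`-lift,
[BLGGT] §1.4 "either zero or equidimensional"). A universal lifting ring itself is not
constructed in the tree; see the module docstring. [cite: BarnetlambEtAl2014, §1.3–1.4] [cite: Kisin2007, (3.3.3) and Cor. 2.7.7] -/
structure PointwiseLiftingRing (Γ : Type) [Group Γ] [TopologicalSpace Γ] (p : ℕ) [Fact p.Prime]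
    (O : Type) [CommRing O] [Algebra O (PadicAlgCl p)] (k : Type) [Field k] [Algebra O k]
    [TopologicalSpace k] {n : ℕ} (ρbar : Γ →ₜ* GL (Fin n) k)
    (C : FramedRep Γ (PadicAlgCl p) n → Prop) : Type 1 where
  /-- The ring `R` (intended: the quotient `R^□_{𝒪,ρ̄,𝒞}` of the universal lifting ring). -/
  R : Type
  /-- `R` is a commutative ring. -/
  [commRing : CommRing R]
  /-- `R` is local. -/
  [isLocalRing : IsLocalRing R]
  /-- `R` is noetherian. -/
  [isNoetherianRing : IsNoetherianRing R]
  /-- `R` is an `𝒪`-algebra. -/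
  [algebra : Algebra O R]
  /-- `R` is `𝔪_R`-adically complete (and separated). -/
  isAdicComplete : IsAdicComplete (maximalIdeal R) R
  /-- `R` is reduced. -/
  isReduced : IsReduced R
  /-- `R` has no `p`-torsion (for `𝒪 = 𝒪_L`: `R` is `𝒪`-flat). -/
  torsionFree : ∀ r : R, (p : R) * r = 0 → r = 0
  /-- The residue map `R → k`, an `𝒪`-algebra homomorphism (so `R/𝔪_R = k = 𝒪/λ` as soon as
  `𝒪 → k` is onto: `residueMap_surjective`, `ker_residueMap`). -/
  residueMap : R →ₐ[O] k
  /-- The lifting `Γ → GL_n(R)` of `ρ̄` carried by `R` (the push-forward of the universal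
  lifting `ρ^□`). -/
  lift : Γ →* GL (Fin n) R
  /-- `lift` is continuous for the `𝔪_R`-adic topology on `R`: the preimage of each congruence
  subgroup `{g : g ≡ 1 mod 𝔪_R^m}` is open in `Γ`. -/
  isOpen_setOf_lift : ∀ m : ℕ, IsOpen {γ : Γ | ∀ i j : Fin n,
    (lift γ : Matrix (Fin n) (Fin n) R) i j - (1 : Matrix (Fin n) (Fin n) R) i j ∈
      maximalIdeal R ^ m}
  /-- `lift` reduces to `ρ̄` modulo `𝔪_R`. -/
  residueMap_lift : ∀ (γ : Γ) (i j : Fin n),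
    residueMap ((lift γ : Matrix (Fin n) (Fin n) R) i j) = (ρbar γ : Matrix (Fin n) (Fin n) k) i j
  /-- The matrix entries of `lift` generate an `𝒪`-subalgebra of `R` which is dense for the
  `𝔪_R`-adic topology (`R` is a quotient of the universal lifting ring `R^□_{𝒪,ρ̄}`). -/
  exists_sub_mem : ∀ (m : ℕ) (r : R), ∃ s ∈ Algebra.adjoin O
    (Set.range fun t : Γ × Fin n × Fin n => (lift t.1 : Matrix (Fin n) (Fin n) R) t.2.1 t.2.2),
      r - s ∈ maximalIdeal R ^ m
  /-- Every `ℚ̄_p`-point `x : R → ℚ̄_p` specialises `lift` to a continuous representation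
  `Γ → GL_n(ℚ̄_p)` which reduces to `ρ̄` and satisfies `𝒞`. -/
  point_spec : ∀ x : R →ₐ[O] PadicAlgCl p,
    ReducesTo O ((Matrix.GeneralLinearGroup.map (x : R →+* PadicAlgCl p)).comp lift)
        ρbar.toMonoidHom ∧
      ∃ hx : Continuous ⇑((Matrix.GeneralLinearGroup.map (x : R →+* PadicAlgCl p)).comp lift),
        C ⟨(Matrix.GeneralLinearGroup.map (x : R →+* PadicAlgCl p)).comp lift, hx⟩
  /-- Every continuous `ρ : Γ → GL_n(𝒪_{ℚ̄_p})` reducing to `ρ̄` and satisfying `𝒞` is the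
  specialisation of `lift` along a unique `ℚ̄_p`-point of `R`. -/
  existsUnique_point : ∀ ρ : FramedRep Γ (PadicAlgCl p) n,
    ReducesTo O ρ.toMonoidHom ρbar.toMonoidHom → C ρ →
      ∃! x : R →ₐ[O] PadicAlgCl p,
        (Matrix.GeneralLinearGroup.map (x : R →+* PadicAlgCl p)).comp lift = ρ.toMonoidHom

namespace PointwiseLiftingRing

attribute [instance] commRing isLocalRing isNoetherianRing algebra

variable {Γ : Type} [Group Γ] [TopologicalSpace Γ] {p : ℕ} [Fact p.Prime] {O : Type} [CommRing O]
  [Algebra O (PadicAlgCl p)] {k : Type} [Field k] [Algebra O k] [TopologicalSpace k] {n : ℕ}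
  {ρbar : Γ →ₜ* GL (Fin n) k} {C : FramedRep Γ (PadicAlgCl p) n → Prop}
  (𝓡 : PointwiseLiftingRing Γ p O k ρbar C)

/-- `R` is `𝔪_R`-adically complete (structure field, as an instance). [folklore] -/
instance instIsAdicComplete : IsAdicComplete (maximalIdeal 𝓡.R) 𝓡.R := 𝓡.isAdicComplete

/-- `R` is reduced (structure field, as an instance). [folklore] -/
instance instIsReduced : IsReduced 𝓡.R := 𝓡.isReduced

/-- `p` is a non-zero-divisor of `R` (structure field `torsionFree`). [folklore] -/
lemma isSMulRegular_natCast : IsSMulRegular 𝓡.R (p : 𝓡.R) :=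
  fun r s h => sub_eq_zero.mp (𝓡.torsionFree (r - s) (by simpa [mul_sub, sub_eq_zero] using h))

/-- The set of matrix entries `lift(γ)_{ij}` of the lifting carried by `R` (they topologically
generate `R` over `𝒪`, `exists_sub_mem`). [cite: BarnetlambEtAl2014, §1.2, proof of Lemma 1.2.1] -/
def entries : Set 𝓡.R :=
  Set.range fun t : Γ × Fin n × Fin n => (𝓡.lift t.1 : Matrix (Fin n) (Fin n) 𝓡.R) t.2.1 t.2.2

/-- Membership of an entry in `entries`. [folklore] -/
lemma apply_mem_entries (γ : Γ) (i j : Fin n) :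
    (𝓡.lift γ : Matrix (Fin n) (Fin n) 𝓡.R) i j ∈ 𝓡.entries :=
  ⟨(γ, i, j), rfl⟩

/-- Restatement of `exists_sub_mem` through `entries`: `𝒪[entries]` is `𝔪_R`-adically dense. [folklore] -/
lemma exists_sub_mem_pow (m : ℕ) (r : 𝓡.R) :
    ∃ s ∈ Algebra.adjoin O 𝓡.entries, r - s ∈ maximalIdeal 𝓡.R ^ m :=
  𝓡.exists_sub_mem m r

/-- **Specialisation** of the lifting along a ring homomorphism `f : R → S`: the representation
`f ∘ lift : Γ → GL_n(S)` ("`ρ^□` pushes forward to `ρ`", [BLGGT] §1.2). [cite: BarnetlambEtAl2014, §1.2] -/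
def specialize {S : Type*} [CommRing S] (f : 𝓡.R →+* S) : Γ →* GL (Fin n) S :=
  (Matrix.GeneralLinearGroup.map f).comp 𝓡.lift

/-- Unfolding lemma: the matrix of `specialize f γ` is the entrywise image of that of `lift γ`. [folklore] -/
@[simp] lemma coe_specialize_apply {S : Type*} [CommRing S] (f : 𝓡.R →+* S) (γ : Γ) :
    ((𝓡.specialize f γ : GL (Fin n) S) : Matrix (Fin n) (Fin n) S) =
      ((𝓡.lift γ : GL (Fin n) 𝓡.R) : Matrix (Fin n) (Fin n) 𝓡.R).map f := rfl

/-- `specialize f` is definitionally `(GL_n(f)) ∘ lift`. [folklore] -/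
lemma specialize_def {S : Type*} [CommRing S] (f : 𝓡.R →+* S) :
    𝓡.specialize f = (Matrix.GeneralLinearGroup.map f).comp 𝓡.lift := rfl

/-- The specialisation along the residue map is `ρ̄` (`lift` lifts `ρ̄`). [folklore] -/
lemma specialize_residueMap : 𝓡.specialize (𝓡.residueMap : 𝓡.R →+* k) = ρbar.toMonoidHom := by
  refine MonoidHom.ext fun γ => ?_
  refine Units.ext (Matrix.ext fun i j => ?_)
  exact 𝓡.residueMap_lift γ i j

/-- If `𝒪 → k` is onto then so is the residue map `R → k`. [folklore] -/
lemma residueMap_surjective (hk : Function.Surjective (algebraMap O k)) :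
    Function.Surjective 𝓡.residueMap := by
  intro c
  obtain ⟨a, rfl⟩ := hk c
  exact ⟨algebraMap O 𝓡.R a, 𝓡.residueMap.commutes a⟩

/-- If `𝒪 → k` is onto, the kernel of the residue map is the maximal ideal: `R/𝔪_R = k`
(the residue field of `R` is that of `𝒪`). [folklore] -/
lemma ker_residueMap (hk : Function.Surjective (algebraMap O k)) :
    RingHom.ker 𝓡.residueMap = maximalIdeal 𝓡.R :=
  IsLocalRing.eq_maximalIdeal
    (RingHom.ker_isMaximal_of_surjective 𝓡.residueMap (𝓡.residueMap_surjective hk))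

/-! #### Points and lifts -/

/-- The continuous representation `Γ → GL_n(ℚ̄_p)` attached to the `ℚ̄_p`-point `x : R → ℚ̄_p`
("`ρ_x`", [BLGGT] §1.2): the specialisation of `lift` along `x`, continuous by `point_spec`. [cite: BarnetlambEtAl2014, §1.2] -/
def liftAt (x : 𝓡.R →ₐ[O] PadicAlgCl p) : FramedRep Γ (PadicAlgCl p) n :=
  ⟨𝓡.specialize (x : 𝓡.R →+* PadicAlgCl p), (𝓡.point_spec x).2.choose⟩

/-- Unfolding lemma for `liftAt`. [folklore] -/
@[simp] lemma liftAt_toMonoidHom (x : 𝓡.R →ₐ[O] PadicAlgCl p) :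
    (𝓡.liftAt x).toMonoidHom = 𝓡.specialize (x : 𝓡.R →+* PadicAlgCl p) := rfl

/-- Unfolding lemma for `liftAt` on elements. [folklore] -/
@[simp] lemma liftAt_apply (x : 𝓡.R →ₐ[O] PadicAlgCl p) (γ : Γ) :
    𝓡.liftAt x γ = Matrix.GeneralLinearGroup.map (x : 𝓡.R →+* PadicAlgCl p) (𝓡.lift γ) := rfl

/-- The representation attached to a point reduces to `ρ̄` (structure field `point_spec`). [cite: BarnetlambEtAl2014, §1.2] -/
lemma reducesTo_liftAt (x : 𝓡.R →ₐ[O] PadicAlgCl p) :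
    ReducesTo O (𝓡.liftAt x).toMonoidHom ρbar.toMonoidHom :=
  (𝓡.point_spec x).1

/-- The representation attached to a point satisfies the condition `𝒞` (structure field
`point_spec`: every `ℚ̄_p`-point of the quotient "corresponds to a representation which has the
property"). [cite: BarnetlambEtAl2014, §1.4] -/
lemma cond_liftAt (x : 𝓡.R →ₐ[O] PadicAlgCl p) : C (𝓡.liftAt x) :=
  (𝓡.point_spec x).2.choose_spec

/-- **The `ℚ̄_p`-point defined by a `𝒞`-lift** `ρ : Γ → GL_n(𝒪_{ℚ̄_p})` of `ρ̄` (the unique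
`x : R → ℚ̄_p` with `x ∘ lift = ρ`, `existsUnique_point`). [cite: BarnetlambEtAl2014, §1.3–1.4] -/
def pointOf (ρ : FramedRep Γ (PadicAlgCl p) n) (hρ : ReducesTo O ρ.toMonoidHom ρbar.toMonoidHom)
    (hC : C ρ) : 𝓡.R →ₐ[O] PadicAlgCl p :=
  (𝓡.existsUnique_point ρ hρ hC).exists.choose

/-- The point of `ρ` specialises `lift` to `ρ`. [folklore] -/
@[simp] lemma specialize_pointOf (ρ : FramedRep Γ (PadicAlgCl p) n)
    (hρ : ReducesTo O ρ.toMonoidHom ρbar.toMonoidHom) (hC : C ρ) :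
    𝓡.specialize (𝓡.pointOf ρ hρ hC : 𝓡.R →+* PadicAlgCl p) = ρ.toMonoidHom :=
  (𝓡.existsUnique_point ρ hρ hC).exists.choose_spec

/-- Uniqueness of the point of `ρ`. [folklore] -/
lemma eq_pointOf {ρ : FramedRep Γ (PadicAlgCl p) n}
    (hρ : ReducesTo O ρ.toMonoidHom ρbar.toMonoidHom) (hC : C ρ) {x : 𝓡.R →ₐ[O] PadicAlgCl p}
    (hx : 𝓡.specialize (x : 𝓡.R →+* PadicAlgCl p) = ρ.toMonoidHom) : x = 𝓡.pointOf ρ hρ hC :=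
  (𝓡.existsUnique_point ρ hρ hC).unique hx (𝓡.specialize_pointOf ρ hρ hC)

/-- Two points with the same attached representation are equal. [folklore] -/
lemma point_ext {x y : 𝓡.R →ₐ[O] PadicAlgCl p}
    (h : 𝓡.specialize (x : 𝓡.R →+* PadicAlgCl p) = 𝓡.specialize (y : 𝓡.R →+* PadicAlgCl p)) :
    x = y :=
  (𝓡.eq_pointOf (𝓡.reducesTo_liftAt y) (𝓡.cond_liftAt y) h).trans
    (𝓡.eq_pointOf (𝓡.reducesTo_liftAt y) (𝓡.cond_liftAt y) rfl).symm

/-- `liftAt (pointOf ρ) = ρ`. [folklore] -/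
@[simp] lemma liftAt_pointOf (ρ : FramedRep Γ (PadicAlgCl p) n)
    (hρ : ReducesTo O ρ.toMonoidHom ρbar.toMonoidHom) (hC : C ρ) :
    𝓡.liftAt (𝓡.pointOf ρ hρ hC) = ρ :=
  ContinuousMonoidHom.ext fun γ =>
    DFunLike.congr_fun (𝓡.specialize_pointOf ρ hρ hC) γ

/-- `pointOf (liftAt x) = x`. [folklore] -/
@[simp] lemma pointOf_liftAt (x : 𝓡.R →ₐ[O] PadicAlgCl p) :
    𝓡.pointOf (𝓡.liftAt x) (𝓡.reducesTo_liftAt x) (𝓡.cond_liftAt x) = x :=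
  (𝓡.eq_pointOf (𝓡.reducesTo_liftAt x) (𝓡.cond_liftAt x) rfl).symm

/-- **`ℚ̄_p`-points of `R` correspond bijectively to continuous `𝒞`-lifts of `ρ̄` with values in
`GL_n(𝒪_{ℚ̄_p})`** — the characterising property of the quotient ([BLGGT] §1.4: "a `ℚ̄_l`-point
of `R^□_{𝒪,ρ̄}` factors through `R^□_{𝒪,ρ̄,{H_τ},*}` if and only if it corresponds to a
representation ... which has [the] property"). [cite: BarnetlambEtAl2014, §1.4] -/
def pointEquiv : (𝓡.R →ₐ[O] PadicAlgCl p) ≃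
    {ρ : FramedRep Γ (PadicAlgCl p) n // ReducesTo O ρ.toMonoidHom ρbar.toMonoidHom ∧ C ρ} where
  toFun x := ⟨𝓡.liftAt x, 𝓡.reducesTo_liftAt x, 𝓡.cond_liftAt x⟩
  invFun ρ := 𝓡.pointOf ρ.1 ρ.2.1 ρ.2.2
  left_inv x := 𝓡.pointOf_liftAt x
  right_inv ρ := Subtype.ext (𝓡.liftAt_pointOf ρ.1 ρ.2.1 ρ.2.2)

/-- Unfolding lemma for `pointEquiv`. [folklore] -/
@[simp] lemma pointEquiv_apply_coe (x : 𝓡.R →ₐ[O] PadicAlgCl p) :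
    (𝓡.pointEquiv x : FramedRep Γ (PadicAlgCl p) n) = 𝓡.liftAt x := rfl

/-- Unfolding lemma for `pointEquiv.symm`. [folklore] -/
@[simp] lemma pointEquiv_symm_apply
    (ρ : {ρ : FramedRep Γ (PadicAlgCl p) n // ReducesTo O ρ.toMonoidHom ρbar.toMonoidHom ∧ C ρ}) :
    𝓡.pointEquiv.symm ρ = 𝓡.pointOf ρ.1 ρ.2.1 ρ.2.2 := rfl

/-! #### The geometric generic fibre `ℚ̄_p ⊗_𝒪 R` and its irreducible components -/

/-- The base change of the `ℚ̄_p`-point `x : R → ℚ̄_p` to the geometric generic fibre: the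
`𝒪`-algebra map `ℚ̄_p ⊗_𝒪 R → ℚ̄_p`, `c ⊗ r ↦ c · x(r)` ([BLGGT] write `R^□_{ρ̄} ⊗ ℚ̄_l` for
`R^□_{𝒪,ρ̄} ⊗_𝒪 ℚ̄_l`; its closed points are the `ℚ̄_l`-points of `R^□_{𝒪,ρ̄}`). [cite: BarnetlambEtAl2014, §1.2] -/
def pointQbar (x : 𝓡.R →ₐ[O] PadicAlgCl p) : PadicAlgCl p ⊗[O] 𝓡.R →ₐ[O] PadicAlgCl p :=
  Algebra.TensorProduct.productMap (AlgHom.id O (PadicAlgCl p)) x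

/-- Unfolding lemma for `pointQbar` on pure tensors. [folklore] -/
@[simp] lemma pointQbar_tmul (x : 𝓡.R →ₐ[O] PadicAlgCl p) (c : PadicAlgCl p) (r : 𝓡.R) :
    𝓡.pointQbar x (c ⊗ₜ r) = c * x r :=
  Algebra.TensorProduct.productMap_apply_tmul _ _ c r

/-- **The irreducible components of the geometric generic fibre** `Spec (ℚ̄_p ⊗_𝒪 R)`: its
minimal prime ideals (for the crystalline deformation ring of regular Hodge type these are also
its connected components, the generic fibre being formally smooth: Kisin 2008, Thm. (3.3.8);
[BLGGT] §1.4). [cite: BarnetlambEtAl2014, §1.3–1.4] -/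
def genericFibreComponents : Set (Ideal (PadicAlgCl p ⊗[O] 𝓡.R)) :=
  minimalPrimes (PadicAlgCl p ⊗[O] 𝓡.R)

/-- Unfolding lemma for `genericFibreComponents`. [folklore] -/
lemma mem_genericFibreComponents_iff (𝔮 : Ideal (PadicAlgCl p ⊗[O] 𝓡.R)) :
    𝔮 ∈ 𝓡.genericFibreComponents ↔ 𝔮 ∈ minimalPrimes (PadicAlgCl p ⊗[O] 𝓡.R) := Iff.rfl

/-- **The points `x`, `y` lie on a common irreducible component of `Spec (ℚ̄_p ⊗_𝒪 R)`**: some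
minimal prime of `ℚ̄_p ⊗_𝒪 R` is contained in both maximal ideals `ker x̄`, `ker ȳ` (`pointQbar`).
Applied to the points of two lifts `ρ₁`, `ρ₂` (`pointOf`) of the crystalline deformation ring of
`ρ̄` of Hodge type `{HT_τ(ρ₁)}` this is the component clause of [BLGGT]'s "`ρ₁` connects to
`ρ₂`", `ρ₁ ∼ ρ₂` (§1.3: "`ρ₁` and `ρ₂` define points on a common irreducible component of
`Spec (R^□_{ρ̄₁} ⊗ ℚ̄_l)`"; §1.4: same with `R^□_{ρ̄₁,{HT_τ(ρ₁)},K'-cris}`). [cite: BarnetlambEtAl2014, §1.3–1.4] -/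
def OnCommonComponent (x y : 𝓡.R →ₐ[O] PadicAlgCl p) : Prop :=
  ∃ 𝔮 ∈ 𝓡.genericFibreComponents,
    𝔮 ≤ RingHom.ker (𝓡.pointQbar x) ∧ 𝔮 ≤ RingHom.ker (𝓡.pointQbar y)

/-- `OnCommonComponent` is symmetric ("`connects' is a symmetric relationship", [BLGGT] §1.3). [cite: BarnetlambEtAl2014, §1.3] -/
lemma OnCommonComponent.symm {x y : 𝓡.R →ₐ[O] PadicAlgCl p} (h : 𝓡.OnCommonComponent x y) :
    𝓡.OnCommonComponent y x := by
  obtain ⟨𝔮, h𝔮, hx, hy⟩ := h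
  exact ⟨𝔮, h𝔮, hy, hx⟩

/-- `OnCommonComponent` is reflexive: the prime ideal `ker x̄` contains a minimal prime. [folklore] -/
lemma onCommonComponent_self (x : 𝓡.R →ₐ[O] PadicAlgCl p) : 𝓡.OnCommonComponent x x := by
  haveI : (RingHom.ker (𝓡.pointQbar x)).IsPrime := RingHom.ker_isPrime _
  obtain ⟨𝔮, h𝔮, hle⟩ :=
    Ideal.exists_minimalPrimes_le (I := (⊥ : Ideal (PadicAlgCl p ⊗[O] 𝓡.R)))
      (J := RingHom.ker (𝓡.pointQbar x)) bot_le
  exact ⟨𝔮, h𝔮, hle, hle⟩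

/-- `OnCommonComponent x y` iff `OnCommonComponent y x`. [folklore] -/
lemma onCommonComponent_comm (x y : 𝓡.R →ₐ[O] PadicAlgCl p) :
    𝓡.OnCommonComponent x y ↔ 𝓡.OnCommonComponent y x :=
  ⟨fun h => h.symm, fun h => h.symm⟩

end PointwiseLiftingRing

/-! ### Crystalline `ℚ̄_p`-valued representations -/

section Fontaine

variable {p : ℕ} [Fact p.Prime] {K : Type} [Field K] [Algebra ℚ_[p] K] {n : ℕ}

/-- **`ρ : Γ_K → GL_n(ℚ̄_p)` is crystalline** relative to the crystalline period-ring datum `𝔅c`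
(accepted `CrystallinePeriodRingData`, intended `B_cris(K)` with `B_cris^{Γ_K} = K₀`): `ρ` has
a model `rE` over a finite extension `E/ℚ_p` inside `ℚ̄_p` (accepted `HasQlModel`) whose
underlying `ℚ_p`-linear representation (accepted `restrictScalarsQl`) is `𝔅c`-admissible,
`dim_{K₀} (B_cris ⊗_{ℚ_p} rE)^{Γ_K} = n [E : ℚ_p]` (accepted `GaloisRep.IsCrystalline`).
Exactly parallel to the accepted `FramedRep.IsDeRhamWith` (Fontaine's theory is `ℚ_p`-linear
on finite-dimensional spaces; every continuous `ρ` has such a model, accepted named fact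
`exists_hasQlModel`). This is Fontaine's definition through `B_cris`; the crystalline
deformation ring below is keyed instead to the equivalent characterisation through `D_pst`
(`PstWeilDeligneData.IsCrystallineFramed`: de Rham with unramified Weil–Deligne representation
and `N = 0`), which is the form in which the summit statement `Langlands` carries its `p`-adic
Hodge-theoretic datum; either condition can be fed to `PointwiseLiftingRing`.
Fontaine 1994, Exposé III §5.1. [cite: FontaineAsterisque223III, §5.1] -/
def FramedRep.IsCrystallineWith (𝔅c : CrystallinePeriodRingData.{0, 0, 0} ℚ_[p] K)
    (ρ : FramedRep (absoluteGaloisGroup K) (PadicAlgCl p) n) : Prop :=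
  ∃ (E : IntermediateField ℚ_[p] (PadicAlgCl p)) (_ : FiniteDimensional ℚ_[p] E)
    (rE : FramedRep (absoluteGaloisGroup K) E n),
    Literature.NumberTheory.Automorphic.HasQlModel ρ E rE ∧
      (Literature.NumberTheory.Automorphic.restrictScalarsQl E rE).IsCrystalline 𝔅c

/-- **`ρ : Γ_K → GL_n(ℚ̄_p)` is de Rham with all Hodge–Tate weights in `[a, b]`** relative to the
period-ring datum `𝔅dR` (accepted `PeriodRingData`, intended `B_dR(K)`): some finite model `rE`
of `ρ` (accepted `HasQlModel`, `restrictScalarsQl`) is `𝔅dR`-admissible (accepted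
`GaloisRep.IsDeRham`) and every element of its multiset of Hodge–Tate weights (accepted
`PeriodRingData.hodgeTateWeights`, the unlabelled multiset) lies in `[a, b]`. This is the
Hodge condition of Kisin's deformation ring "with Hodge–Tate weights in the interval `[a, b]`"
(Kisin 2008, Introduction; Thm. (2.5.5) for `[0, h]`). [cite: Kisin2007, Introduction and Thm. 2.5.5] -/
def FramedRep.IsDeRhamWithWeightsIn
    (𝔅dR : PeriodRingData.{0, 0, 0, 0} (absoluteGaloisGroup K) ℚ_[p] K) (a b : ℤ)
    (ρ : FramedRep (absoluteGaloisGroup K) (PadicAlgCl p) n) : Prop :=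
  ∃ (E : IntermediateField ℚ_[p] (PadicAlgCl p)) (_ : FiniteDimensional ℚ_[p] E)
    (rE : FramedRep (absoluteGaloisGroup K) E n),
    Literature.NumberTheory.Automorphic.HasQlModel ρ E rE ∧
      (Literature.NumberTheory.Automorphic.restrictScalarsQl E rE).IsDeRham 𝔅dR ∧
        ∀ w ∈ 𝔅dR.hodgeTateWeights (Literature.NumberTheory.Automorphic.restrictScalarsQl E rE),
          a ≤ w ∧ w ≤ b

/-- Enlarging the interval preserves "de Rham with weights in the interval". [folklore] -/
lemma FramedRep.IsDeRhamWithWeightsIn.mono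
    {𝔅dR : PeriodRingData.{0, 0, 0, 0} (absoluteGaloisGroup K) ℚ_[p] K} {a b a' b' : ℤ}
    {ρ : FramedRep (absoluteGaloisGroup K) (PadicAlgCl p) n} (h : ρ.IsDeRhamWithWeightsIn 𝔅dR a b)
    (ha : a' ≤ a) (hb : b ≤ b') : ρ.IsDeRhamWithWeightsIn 𝔅dR a' b' := by
  obtain ⟨E, hE, rE, hmod, hdR, hw⟩ := h
  exact ⟨E, hE, rE, hmod, hdR, fun w hw' => ⟨ha.trans (hw w hw').1, (hw w hw').2.trans hb⟩⟩

end Fontaine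

/-! ### Crystalline deformation rings, relative to the `p`-adic Hodge datum of the summit -/

section Pst

variable {K : Type} [Field K] [ValuativeRel K] [TopologicalSpace K] [IsNonarchimedeanLocalField K]
  {p : ℕ} [Fact p.Prime] {n : ℕ}

namespace PstWeilDeligneData

/-- **`ρ : Γ_K → GL_n(ℚ̄_p)` is crystalline**, characterised through `D_pst` relative to the
datum `𝔇` (accepted `PstWeilDeligneData`: intended `B_dR(K)` and `WD ∘ D_pst`): `ρ` is de Rham
(`IsDeRhamFramed`) and its Weil–Deligne representation `(r, N)` (`IsWeilDeligneOf`) has `N = 0`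
and is unramified (inertia acts trivially). For the genuine datum this is equivalent to
Fontaine's "`B_cris`-admissible": a de Rham representation is potentially semi-stable
(Berger), it is semi-stable over `K` iff the inertia group `I_K` acts trivially on `D_pst`
(semi-stability is insensitive to unramified extensions), and crystalline iff moreover `N = 0`
(Fontaine 1994, Exposé VIII §1.3, §2.3.7; the unramified case is the datum's axiom
`wd_of_isLocallyUnramified`). This is the phrasing "de Rham, `N = 0`, `WD` unramified" used by
the summit statement `Langlands` for "crystalline at `v ∣ p`". [cite: FontaineAsterisque223VIII, §1.3 and §2.3.7] [cite: FontaineAsterisque223III, §5.1] [cite: BarnetlambEtAl2014, §1.4] -/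
def IsCrystallineFramed (𝔇 : PstWeilDeligneData K p)
    (ρ : FramedRep (absoluteGaloisGroup K) (PadicAlgCl p) n) : Prop :=
  𝔇.IsDeRhamFramed ρ ∧ ∃ r, 𝔇.IsWeilDeligneOf ρ r ∧ r.N = 0 ∧ WeilGroup.IsUnramifiedRep r.ρ

/-- Crystalline representations are de Rham. [cite: FontaineAsterisque223III, §5.1] -/
lemma IsCrystallineFramed.isDeRhamFramed {𝔇 : PstWeilDeligneData K p}
    {ρ : FramedRep (absoluteGaloisGroup K) (PadicAlgCl p) n} (h : 𝔇.IsCrystallineFramed ρ) :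
    𝔇.IsDeRhamFramed ρ :=
  h.1

/-- **Unramified representations are crystalline** — derived from the datum's axioms
(`isDeRhamWith_of_isLocallyUnramified`, `exists_of_isDeRham`, `wd_of_isLocallyUnramified`).
Fontaine 1994, Exposé III §5 (unramified ⇒ crystalline). [cite: FontaineAsterisque223III, §5] -/
theorem isCrystallineFramed_of_isLocallyUnramified (𝔇 : PstWeilDeligneData K p)
    {ρ : FramedRep (absoluteGaloisGroup K) (PadicAlgCl p) n} (h : ρ.IsLocallyUnramified) :
    𝔇.IsCrystallineFramed ρ := by
  have hdR : 𝔇.IsDeRhamFramed ρ := 𝔇.isDeRhamFramed_of_isLocallyUnramified h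
  obtain ⟨r, hr⟩ := hdR.exists_isWeilDeligneOf
  exact ⟨hdR, r, hr, 𝔇.wd_of_isLocallyUnramified ρ r h hr⟩

/-- `ρ : Γ_K → GL_n(ℚ̄_p)` is de Rham with all Hodge–Tate weights in `[a, b]` relative to the
datum `𝔇` (its period ring `𝔇.𝔅`, intended `B_dR(K)`, and its `ℚ_p`-algebra structure on `K`):
`FramedRep.IsDeRhamWithWeightsIn 𝔇.𝔅 a b ρ`. [cite: Kisin2007, Introduction and Thm. 2.5.5] -/
def IsDeRhamWithWeightsIn (𝔇 : PstWeilDeligneData K p) (a b : ℤ)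
    (ρ : FramedRep (absoluteGaloisGroup K) (PadicAlgCl p) n) : Prop :=
  letI := 𝔇.algebra; ρ.IsDeRhamWithWeightsIn 𝔇.𝔅 a b

/-- Enlarging the interval preserves `IsDeRhamWithWeightsIn`. [folklore] -/
lemma IsDeRhamWithWeightsIn.mono {𝔇 : PstWeilDeligneData K p} {a b a' b' : ℤ}
    {ρ : FramedRep (absoluteGaloisGroup K) (PadicAlgCl p) n} (h : 𝔇.IsDeRhamWithWeightsIn a b ρ)
    (ha : a' ≤ a) (hb : b ≤ b') : 𝔇.IsDeRhamWithWeightsIn a' b' ρ := by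
  letI := 𝔇.algebra
  exact FramedRep.IsDeRhamWithWeightsIn.mono h ha hb

/-- **Unramified representations have all Hodge–Tate weights `0`** relative to `𝔇`: every
continuous unramified `ρ : Γ_K → GL_n(ℚ̄_p)` is de Rham with weights in `[0, 0]`. True for
the genuine `B_dR(K)` (an unramified `ρ` is crystalline with `D = (Ŵ(k̄)[1/p] ⊗ ρ)^{Γ_K}` and
Hodge filtration `Fil⁰ = D`, `Fil¹ = 0`; Fontaine 1994, Exposé III §5); it is a predicate on
the datum (a non-degeneracy property that, e.g., the datum with trivial `Γ_K`-action — for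
which only the trivial representation is admissible — does not have), asserted of the genuine
datum by the named fact `CrystallineDeformationRing.nonempty`. [cite: FontaineAsterisque223III, §5] -/
def UnramifiedWeightsZero (𝔇 : PstWeilDeligneData K p) : Prop :=
  ∀ {n : ℕ} (ρ : FramedRep (absoluteGaloisGroup K) (PadicAlgCl p) n),
    ρ.IsLocallyUnramified → 𝔇.IsDeRhamWithWeightsIn 0 0 ρ

end PstWeilDeligneData

end Pst

/-- **The crystalline deformation ring of `ρ̄ : Γ_K → GL_n(k)` of Hodge type `H`** (Kisin):
the reduced, `p`-torsion-free quotient of the universal lifting ring `R^□_{𝒪,ρ̄}` whose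
`ℚ̄_p`-points are exactly the lifts `ρ : Γ_K → GL_n(𝒪_{ℚ̄_p})` of `ρ̄` which are crystalline
(relative to the `p`-adic Hodge datum `𝔇 : PstWeilDeligneData K p` of the summit statement,
`PstWeilDeligneData.IsCrystallineFramed`: de Rham, Weil–Deligne representation unramified with
`N = 0`) and satisfy the Hodge-type condition `H` — an instance of `PointwiseLiftingRing`, so
all of its API (`lift`, `pointOf`, `pointEquiv`, `genericFibreComponents`, `OnCommonComponent`,
…) applies, and when non-zero it is unique up to unique isomorphism ([BLGGT] §1.4). The Hodge
type is a PARAMETER `H` (a condition on `ρ : Γ_K → GL_n(ℚ̄_p)`):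
* [BLGGT]'s `R^□_{𝒪,ρ̄,{H_τ},cris}` = Kisin's `R^{□,v}_{cr}` (Kisin 2008, Cor. (2.7.7) with trivial
  Galois type, (3.3.3); its generic fibre is formally smooth and equidimensional of dimension
  `n² + dim ad D_K/Fil⁰`, Thm. (3.3.8)) is the instance `H ρ := ∀ τ : K ↪ ℚ̄_p, HT_τ(ρ) = H_τ`
  (labelled Hodge–Tate weights: definition item `LabelledHodgeTateWeights`);
* Kisin's ring of crystalline lifts with Hodge–Tate weights in `[a, b]` (Introduction; Thm.
  (2.5.5) and Cor. (2.7.7)) is the instance `H := 𝔇.IsDeRhamWithWeightsIn a b`, whose existence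
  for the genuine datum is the named fact `CrystallineDeformationRing.nonempty`
  (through the predicate `PstWeilDeligneData.HasCrystallineDeformationRings`);
* `* = K'-cris` ("crystalline after restriction to `G_{K'}`") is the instance obtained by
  replacing `IsUnramifiedRep r.ρ` with triviality of `r.ρ` on the inertia of `K'` — all
  expressible with the one datum `𝔇` for `K`.
Intended coefficients: `𝒪 = 𝒪_L ⊆ ℚ̄_p` for a finite `L/ℚ_p` containing the images of all
`K ↪ ℚ̄_p`, `k = 𝒪_L/λ`, `ρ̄ : ModPGaloisRep K k n` (accepted). [cite: Kisin2007, Cor. 2.7.7 and Thm. 3.3.8] [cite: BarnetlambEtAl2014, §1.4] -/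
abbrev CrystallineDeformationRing (p : ℕ) [Fact p.Prime] (K : Type) [Field K] [ValuativeRel K]
    [TopologicalSpace K] [IsNonarchimedeanLocalField K] {n : ℕ} (O : Type) [CommRing O]
    [Algebra O (PadicAlgCl p)] (k : Type) [Field k] [Algebra O k] [TopologicalSpace k]
    (ρbar : FramedRep (absoluteGaloisGroup K) k n) (𝔇 : PstWeilDeligneData K p)
    (H : FramedRep (absoluteGaloisGroup K) (PadicAlgCl p) n → Prop) : Type 1 :=
  PointwiseLiftingRing (absoluteGaloisGroup K) p O k ρbar fun ρ => 𝔇.IsCrystallineFramed ρ ∧ H ρ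

section Pst

variable {K : Type} [Field K] [ValuativeRel K] [TopologicalSpace K] [IsNonarchimedeanLocalField K]
  {p : ℕ} [Fact p.Prime] {n : ℕ}

namespace CrystallineDeformationRing

variable {O : Type} [CommRing O] [Algebra O (PadicAlgCl p)] {k : Type} [Field k] [Algebra O k]
  [TopologicalSpace k] {ρbar : FramedRep (absoluteGaloisGroup K) k n} {𝔇 : PstWeilDeligneData K p}
  {H : FramedRep (absoluteGaloisGroup K) (PadicAlgCl p) n → Prop}
  (𝓡 : CrystallineDeformationRing p K O k ρbar 𝔇 H)

/-- Every `ℚ̄_p`-point of the crystalline deformation ring carries a crystalline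
representation (characterising property). [cite: Kisin2007, Cor. 2.7.7] -/
lemma isCrystallineFramed_liftAt (x : 𝓡.R →ₐ[O] PadicAlgCl p) :
    𝔇.IsCrystallineFramed (𝓡.liftAt x) :=
  (𝓡.cond_liftAt x).1

/-- Every `ℚ̄_p`-point of the crystalline deformation ring carries a de Rham representation. [cite: Kisin2007, Cor. 2.7.7] -/
lemma isDeRhamFramed_liftAt (x : 𝓡.R →ₐ[O] PadicAlgCl p) : 𝔇.IsDeRhamFramed (𝓡.liftAt x) :=
  (𝓡.isCrystallineFramed_liftAt x).isDeRhamFramed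

/-- Every `ℚ̄_p`-point of the crystalline deformation ring of Hodge type `H` carries a
representation of Hodge type `H` (characterising property). [cite: Kisin2007, Cor. 2.7.7] -/
lemma hodgeType_liftAt (x : 𝓡.R →ₐ[O] PadicAlgCl p) : H (𝓡.liftAt x) :=
  (𝓡.cond_liftAt x).2

end CrystallineDeformationRing

/-! ### Existence (Kisin) -/

variable (p) in
/-- The ring of integers `𝒪_L = {x ∈ L : ‖x‖ ≤ 1}` of an intermediate field `ℚ_p ⊆ L ⊆ ℚ̄_p`,
as the valuation subring of `L` for the restriction of the valuation (= norm) of `ℚ̄_p`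
(Mathlib `PadicAlgCl.valued`). [folklore] -/
abbrev intermediateFieldIntegers (L : IntermediateField ℚ_[p] (PadicAlgCl p)) :
    ValuationSubring L :=
  ((Valued.v : Valuation (PadicAlgCl p) NNReal).comap (algebraMap L (PadicAlgCl p))).valuationSubring

/-- Membership in `𝒪_L`: norm at most `1` in `ℚ̄_p`. [folklore] -/
lemma mem_intermediateFieldIntegers_iff (L : IntermediateField ℚ_[p] (PadicAlgCl p)) (x : L) :
    x ∈ intermediateFieldIntegers p L ↔ ‖(x : PadicAlgCl p)‖ ≤ 1 := by
  rw [Valuation.mem_valuationSubring_iff, Valuation.comap_apply,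
    PadicAlgCl.valuation_def, ← NNReal.coe_le_coe, coe_nnnorm, NNReal.coe_one]
  rfl

/-- Elements of the maximal ideal of `𝒪_L` have norm `< 1` in `ℚ̄_p`. [folklore] -/
lemma norm_lt_one_of_mem_maximalIdeal (L : IntermediateField ℚ_[p] (PadicAlgCl p))
    {x : intermediateFieldIntegers p L} (hx : x ∈ maximalIdeal (intermediateFieldIntegers p L)) :
    ‖((x : L) : PadicAlgCl p)‖ < 1 := by
  have h1 := (ValuationSubring.valuation_lt_one_iff _ x).mp hx
  have h2 := (Valuation.isEquiv_valuation_valuationSubring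
    ((Valued.v : Valuation (PadicAlgCl p) NNReal).comap
      (algebraMap L (PadicAlgCl p)))).lt_one_iff_lt_one.mpr h1
  rw [Valuation.comap_apply, PadicAlgCl.valuation_def, ← NNReal.coe_lt_coe, coe_nnnorm,
    NNReal.coe_one] at h2
  exact h2

/-- The `𝒪_L`-algebra structure on `ℚ̄_p` given by the inclusions `𝒪_L ⊆ L ⊆ ℚ̄_p` (a `def`,
turned on locally with `letI`). [folklore] -/
abbrev intermediateFieldIntegers.algebraPadicAlgCl (L : IntermediateField ℚ_[p] (PadicAlgCl p)) :
    Algebra (intermediateFieldIntegers p L) (PadicAlgCl p) :=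
  ((algebraMap L (PadicAlgCl p)).comp (algebraMap (intermediateFieldIntegers p L) L)).toAlgebra

/-- **The datum `𝔇` admits Kisin's crystalline deformation rings (interval form).** For every
finite `L/ℚ_p` inside `ℚ̄_p` with integers `𝒪_L` and residue field `k_L = 𝒪_L/λ` (discrete),
every continuous `ρ̄ : Γ_K → GL_n(k_L)` and all integers `a`, `b` such that `ρ̄` has at least
one continuous lift `Γ_K → GL_n(𝒪_{ℚ̄_p})` which is `𝔇`-crystalline with Hodge–Tate weights in
`[a, b]` (otherwise the quotient in question is the zero ring: [BLGGT] §1.4 "either zero or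
equidimensional"), the reduced `p`-torsion-free quotient of the universal lifting ring
`R^□_{𝒪_L,ρ̄}` whose `ℚ̄_p`-points are the crystalline lifts of `ρ̄` with Hodge–Tate weights in
`[a, b]` exists as a (non-zero) complete noetherian local ring:
`CrystallineDeformationRing p K 𝒪_L k_L ρ̄ 𝔇 (𝔇.IsDeRhamWithWeightsIn a b)` is inhabited. This is
a PREDICATE on the datum; that the genuine datum (`B_dR`, `WD ∘ D_pst`) satisfies it is Kisin's
theorem, recorded as the named fact `CrystallineDeformationRing.nonempty`: Kisin 2008, Theorem
of the Introduction (quotient of `R_{V_𝔽}` whose points in finite extensions are the lifts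
semi-stable over `L ⊇ K` with Hodge–Tate weights in `[a, b]`; here `L = K`), Thm. (2.5.5)
(`[0, h]`), Cor. (2.7.7) (crystalline = the closed condition `N = 0`), (3.3.3) (framed version
`R^□_{V_𝔽}`); the reduced/`p`-torsion-free/points formulation and the passage between
`ℚ̄_p`-points and `𝒪_{ℚ̄_p}`-valued lifts are [BLGGT] §1.2–1.4. [cite: Kisin2007, Introduction, Thm. 2.5.5 and Cor. 2.7.7] [cite: BarnetlambEtAl2014, §1.4] -/
def PstWeilDeligneData.HasCrystallineDeformationRings (𝔇 : PstWeilDeligneData K p) : Prop :=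
  ∀ (L : IntermediateField ℚ_[p] (PadicAlgCl p)) [FiniteDimensional ℚ_[p] L] (n : ℕ),
    letI := intermediateFieldIntegers.algebraPadicAlgCl L
    letI : TopologicalSpace (ResidueField (intermediateFieldIntegers p L)) := ⊥
    ∀ (ρbar : FramedRep (absoluteGaloisGroup K) (ResidueField (intermediateFieldIntegers p L)) n)
      (a b : ℤ),
      (∃ ρ : FramedRep (absoluteGaloisGroup K) (PadicAlgCl p) n,
          ReducesTo (intermediateFieldIntegers p L) ρ.toMonoidHom ρbar.toMonoidHom ∧
            𝔇.IsCrystallineFramed ρ ∧ 𝔇.IsDeRhamWithWeightsIn a b ρ) →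
      Nonempty (CrystallineDeformationRing p K (intermediateFieldIntegers p L)
        (ResidueField (intermediateFieldIntegers p L)) ρbar 𝔇 (𝔇.IsDeRhamWithWeightsIn a b))

omit [ValuativeRel K] [TopologicalSpace K] [IsNonarchimedeanLocalField K] in
/-- The trivial representation `Γ_K → GL_n(ℚ̄_p)` reduces, through `𝒪_L`, to the trivial
representation `Γ_K → GL_n(k_L)`. [folklore] -/
lemma reducesTo_one_one (L : IntermediateField ℚ_[p] (PadicAlgCl p)) :
    letI := intermediateFieldIntegers.algebraPadicAlgCl L
    ReducesTo (intermediateFieldIntegers p L)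
      (1 : absoluteGaloisGroup K →* GL (Fin n) (PadicAlgCl p))
      (1 : absoluteGaloisGroup K →* GL (Fin n) (ResidueField (intermediateFieldIntegers p L))) := by
  letI := intermediateFieldIntegers.algebraPadicAlgCl L
  intro γ i j a ha
  -- the residue of `a` is the `(i, j)` entry of the identity matrix
  set c : intermediateFieldIntegers p L := if i = j then 1 else 0 with hc
  have hres : IsLocalRing.residue _ (a - c) = 0 := by
    rw [map_sub, sub_eq_zero, ← IsLocalRing.ResidueField.algebraMap_eq, ha, hc]
    simp only [MonoidHom.one_apply, Units.val_one, Matrix.one_apply]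
    split_ifs <;> simp
  have hmem : a - c ∈ maximalIdeal (intermediateFieldIntegers p L) :=
    (IsLocalRing.residue_eq_zero_iff _).mp hres
  have hlt := norm_lt_one_of_mem_maximalIdeal L hmem
  have hentry : (((1 : absoluteGaloisGroup K →* GL (Fin n) (PadicAlgCl p)) γ :
      GL (Fin n) (PadicAlgCl p)) : Matrix (Fin n) (Fin n) (PadicAlgCl p)) i j =
        algebraMap (intermediateFieldIntegers p L) (PadicAlgCl p) c := by
    simp only [MonoidHom.one_apply, Units.val_one, Matrix.one_apply, hc]
    split_ifs <;> simp
  rw [hentry, ← map_sub, ← norm_neg, ← map_neg, neg_sub]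
  exact hlt

/-- **Non-vacuity of `HasCrystallineDeformationRings`**: for a datum with
`UnramifiedWeightsZero`, the crystalline deformation ring of the TRIVIAL residual
representation `ρ̄ = 1 : Γ_K → GL_n(k_L)` with Hodge–Tate weights in `[a, b] ∋ 0` exists —
its `ℚ̄_p`-points include the trivial representation, which is unramified, hence crystalline
(`isCrystallineFramed_of_isLocallyUnramified`) with weights `0`. (For `ρ̄` trivial this ring
is the object of [BLGGT] Lemma 1.4.1 and of the statement "if `ρ̄` is trivial then
`Spec R^□_{cr-ord}[1/l]` is geometrically irreducible", §1.4.) [cite: BarnetlambEtAl2014, §1.4] -/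
theorem PstWeilDeligneData.HasCrystallineDeformationRings.nonempty_one {𝔇 : PstWeilDeligneData K p}
    (h : 𝔇.HasCrystallineDeformationRings) (h0 : 𝔇.UnramifiedWeightsZero)
    (L : IntermediateField ℚ_[p] (PadicAlgCl p)) [FiniteDimensional ℚ_[p] L] (n : ℕ) {a b : ℤ}
    (ha : a ≤ 0) (hb : 0 ≤ b) :
    letI := intermediateFieldIntegers.algebraPadicAlgCl L
    letI : TopologicalSpace (ResidueField (intermediateFieldIntegers p L)) := ⊥
    Nonempty (CrystallineDeformationRing p K (intermediateFieldIntegers p L)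
      (ResidueField (intermediateFieldIntegers p L))
      (1 : FramedRep (absoluteGaloisGroup K) (ResidueField (intermediateFieldIntegers p L)) n) 𝔇
      (𝔇.IsDeRhamWithWeightsIn a b)) := by
  letI := intermediateFieldIntegers.algebraPadicAlgCl L
  letI : TopologicalSpace (ResidueField (intermediateFieldIntegers p L)) := ⊥
  refine h L n 1 a b ⟨1, ?_, ?_, ?_⟩
  · exact reducesTo_one_one L
  · exact 𝔇.isCrystallineFramed_of_isLocallyUnramified fun _ _ => rfl
  · exact (h0 (1 : FramedRep (absoluteGaloisGroup K) (PadicAlgCl p) n) fun _ _ => rfl).mono ha hb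

/-- **Existence of crystalline deformation rings (Kisin) for the genuine `p`-adic Hodge datum.**
For every finite extension `K` of `ℚ_p` (every non-archimedean local field of characteristic
zero given as a `ℚ_p`-algebra) there is a `p`-adic Hodge datum `𝔇 : PstWeilDeligneData K p`
with the given `ℚ_p`-algebra structure — INTENDED: Fontaine's `B_dR(K)` and `WD ∘ D_pst`, as in
the accepted `PstWeilDeligneData.nonempty`, which this fact refines — for which unramified
representations have Hodge–Tate weights `0` (`UnramifiedWeightsZero`; Fontaine 1994, Exposé III
§5) and Kisin's crystalline deformation rings with Hodge–Tate weights in any interval `[a, b]`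
exist (`HasCrystallineDeformationRings`; Kisin 2008, Theorem of the Introduction, Thm. (2.5.5),
Cor. (2.7.7), (3.3.3), in the formulation of [BLGGT] §1.4). Consumers holding a datum `𝔇` in
scope (e.g. `ReciprocityData.pst`) hypothesize `𝔇.HasCrystallineDeformationRings` directly;
this named fact (D-0014) records that the genuine datum has the property. Degenerate period-ring
data are excluded by the axioms of `PstWeilDeligneData` (every unramified `ρ` is de Rham —
false for the datum with trivial `Γ_K`-action, for which only the trivial representation is
admissible, and for `B = K̄`, for which admissible means finite image) together with
`UnramifiedWeightsZero`. [cite: Kisin2007, Introduction, Thm. 2.5.5 and Cor. 2.7.7] [cite: BarnetlambEtAl2014, §1.4] [cite: FontaineAsterisque223III, §5] -/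
def CrystallineDeformationRing.nonempty : Prop :=
  ∀ (K : Type) [Field K] [ValuativeRel K] [TopologicalSpace K] [IsNonarchimedeanLocalField K]
    (p : ℕ) [Fact p.Prime] [CharZero K] (_ : Algebra ℚ_[p] K),
    ∃ 𝔇 : PstWeilDeligneData K p, 𝔇.algebra = ‹Algebra ℚ_[p] K› ∧
      𝔇.UnramifiedWeightsZero ∧ 𝔇.HasCrystallineDeformationRings

end Pst

end Literature.NumberTheory.GaloisRepresentations

end
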